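import Literature.Geometry.Kaehler.ComplexTorusAnalyticHypersurfaceSectionsProper
import Literature.Geometry.Kaehler.ComplexTorusAnalyticSetsNoetherian
import Literature.Geometry.Kaehler.ComplexTorusAnalyticSetsNull
import HarnessLib

/-!
# The translates of a hypersurface that cut a subvariety improperly form a closed analytic null set

Layer `Literature/Geometry/Kaehler`; lane `lit-hodgefound`, seat p07 (programme «INTERSECTION NUMBERS ARE
POINT COUNTS», file 26). Let `X = E/Λ` be a compact complex torus of dimension `g = q + 1`, `Y ⊆ X` closed
analytic of pure dimension `r + 1` and `D ⊆ X` a hypersurface (closed analytic of pure dimension `q = g − 1`).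

By `ComplexTorusAnalyticHypersurfaceSectionsProper` (file 23) the section `Y ∩ (t + D)` by the translate
`t + D` is PROPER (empty or of pure dimension `r`) iff NO IRREDUCIBLE COMPONENT of `Y` lies inside `t + D`
[Chirka1989, §5.3 Cor. 1; Fulton1998, §7.1 and Example 8.4.6]. The present file describes the EXCEPTIONAL
("bad") translates

  `B(Y, D) = {t ∈ X | some irreducible component C of Y satisfies C ⊆ t + D}`
          `= {t ∈ X | Y ∩ (t + D) is neither empty nor of pure dimension r}`:

* §1 for every subset `C` and closed analytic `D` the set `{t | C ⊆ t + D} = −⋂_{c ∈ C} (D − c)` is CLOSED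
  ANALYTIC — an arbitrary intersection of translates, analytic by the Noetherian property of the family of
  closed analytic subsets of the compact `X` [Chirka1989, §5.7 Theorem, p. 62]
  (`ComplexTorusAnalyticSetsNoetherian.isAnalyticSet_setOf_vadd_set_subset`); `Y` having finitely many
  irreducible components [Chirka1989, §5.4 Thm., p. 57], `B(Y, D)` is closed analytic
  (`isAnalyticSet_setOf_exists_isIrreducibleComponent_subset_vadd`);
* §2 `B(Y, D)` is exactly the set of improper translates (`setOf_not_inter_vadd_eq_empty_or_hasPureDim_eq`),
  so the IMPROPER TRANSLATES FORM A CLOSED ANALYTIC SUBSET OF `X`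
  (`isAnalyticSet_setOf_not_inter_vadd_eq_empty_or_hasPureDim`) and the proper ones an open subset —
  sharpening the openness by semicontinuity of `ComplexTorusAnalyticProperIntersectionOpen` in the
  hypersurface case;
* §3 by the moving lemma [Fulton1998, §11.4, Example 11.4.5, Appendix B.9.2; Kleiman1974Transversality,
  Thm. 2] (`ComplexTorusAnalyticMovingLemma.ae_inter_translate_eq_empty_or_hasPureDim`) Haar-almost every
  translate is proper, so `B(Y, D)` is a closed analytic subset of HAAR MEASURE ZERO, `≠ X`, with EMPTY
  INTERIOR, and the proper translates form an OPEN DENSE subset of FULL MEASURE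
  (`volume_setOf_exists_isIrreducibleComponent_subset_vadd_eq_zero`,
  `isOpen_dense_setOf_inter_vadd_eq_empty_or_hasPureDim`); the same statements in the
  `(· + t)⁻¹' D = D − t` spelling used for the iterated sections `Z(τ) = Y ∩ ⋂ⱼ (Dⱼ − τⱼ)` of files 9–25
  (§4).

* §5 (appended) GENERAL `Y₂` in place of the hypersurface `D`: for closed analytic `Y₁` and `Y₂` of pure
  dimension `d₂ < g`, the swallowing locus `B(Y₁, Y₂) = {t | ∃ C component of Y₁, C ⊆ t + Y₂}` is a
  closed analytic HAAR-NULL subset with empty interior — elementary: `{t | C ⊆ t + Y₂} ⊆ c − Y₂` for any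
  `c ∈ C`, a translate of `−Y₂`, which is Haar-null (`ComplexTorusAnalyticSetsNull`,
  [Chirka1989, §3.7 Cor.]); and `B(Y₁, Y₂)` consists of improper translates when `Y₁` has pure dimension
  `d₁` greater than the expected dimension (`setOf_exists_isIrreducibleComponent_subset_vadd_subset_setOf_not`).

This is the classical picture "the hypersurfaces containing a given subvariety form a closed subvariety of
the parameter space" [Fulton1998, Appendix B.9.2; Kleiman1974Transversality, §2], here for the family of
translates `{t + D}_{t ∈ X}` parametrised by the torus itself.

## References

* [Chirka1989] E. M. Chirka, *Complex Analytic Sets*, Kluwer 1989, §5.3 Cor. 1 (p. 55), §5.4 Thm. (p. 57),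
  §5.7 Theorem (p. 62).
* [Fulton1998] W. Fulton, *Intersection Theory*, 2nd ed., Springer 1998, §7.1, Example 8.4.6, §11.4,
  Example 11.4.5, Appendix B.9.2.
* [Kleiman1974Transversality] S. L. Kleiman, *The transversality of a general translate*, Compositio Math. 28
  (1974) 287–297, Thm. 2.
-/

open scoped Manifold Topology Pointwise
open MeasureTheory Set Function Filter Module

namespace Literature.Geometry.Kaehler
namespace ComplexTorus

universe u

variable {ι : Type*} [Fintype ι] [DecidableEq ι] {E : Type u} [NormedAddCommGroup E] [InnerProductSpace ℂ E]
  [FiniteDimensional ℂ E] [MeasurableSpace E] [BorelSpace E] (Φ : (ι → ℝ) ≃L[ℝ] E)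

/-! ### §1 `{t | C ⊆ t + D}` and the swallowing locus `B(Y, D)` are closed analytic -/

omit [DecidableEq ι] [MeasurableSpace E] [BorelSpace E] in
/-- **`{t ∈ X | C ⊆ t + D}` is closed analytic** for ANY subset `C` and every closed analytic `D`: it is
`−{s | s + C ⊆ D} = −⋂_{c ∈ C} (D − c)`. [cite: Chirka1989, §5.7 Theorem, p. 62] -/
theorem isAnalyticSet_setOf_subset_vadd (C : Set (ComplexTorus Φ)) {D : Set (ComplexTorus Φ)}
    (hD : IsAnalyticSet 𝓘(ℂ, E) D) : IsAnalyticSet 𝓘(ℂ, E) {t : ComplexTorus Φ | C ⊆ t +ᵥ D} := by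
  have h : {t : ComplexTorus Φ | C ⊆ t +ᵥ D} = -{s : ComplexTorus Φ | s +ᵥ C ⊆ D} := by
    ext t
    rw [Set.mem_neg, mem_setOf_eq, mem_setOf_eq, Set.subset_vadd_set_iff]
  rw [h]
  exact isAnalyticSet_neg Φ (isAnalyticSet_setOf_vadd_set_subset Φ C hD)

omit [DecidableEq ι] [MeasurableSpace E] [BorelSpace E] in
/-- The same in the `D − t = (· + t)⁻¹' D` spelling of the iterated sections `Z(τ)`:
**`{t ∈ X | C ⊆ D − t} = {t | t + C ⊆ D}` is closed analytic.** [cite: Chirka1989, §5.7 Theorem, p. 62] -/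
theorem isAnalyticSet_setOf_subset_preimage_add (C : Set (ComplexTorus Φ)) {D : Set (ComplexTorus Φ)}
    (hD : IsAnalyticSet 𝓘(ℂ, E) D) :
    IsAnalyticSet 𝓘(ℂ, E) {t : ComplexTorus Φ | C ⊆ (fun x ↦ x + t) ⁻¹' D} := by
  have h : {t : ComplexTorus Φ | C ⊆ (fun x ↦ x + t) ⁻¹' D} = {t : ComplexTorus Φ | t +ᵥ C ⊆ D} := by
    ext t
    rw [mem_setOf_eq, mem_setOf_eq, Set.vadd_set_subset_iff]
    simp only [subset_def, mem_preimage, vadd_eq_add]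
    constructor
    · intro h x hx
      rw [add_comm]
      exact h x hx
    · intro h x hx
      rw [add_comm]
      exact h hx
  rw [h]
  exact isAnalyticSet_setOf_vadd_set_subset Φ C hD

omit [DecidableEq ι] [MeasurableSpace E] [BorelSpace E] in
/-- **THE SWALLOWING LOCUS IS CLOSED ANALYTIC.** For closed analytic `Y, D ⊆ X` the set
`B(Y, D) = {t ∈ X | ∃ C irreducible component of Y, C ⊆ t + D}` is a closed analytic subset of `X`: a finite
union (finitely many components, `X` compact) of the closed analytic `{t | C ⊆ t + D}`.
[cite: Chirka1989, §5.4 Thm. (p. 57) and §5.7 Theorem (p. 62)] [cite: Fulton1998, Appendix B.9.2] -/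
theorem isAnalyticSet_setOf_exists_isIrreducibleComponent_subset_vadd {Y D : Set (ComplexTorus Φ)}
    (hY : IsAnalyticSet 𝓘(ℂ, E) Y) (hD : IsAnalyticSet 𝓘(ℂ, E) D) :
    IsAnalyticSet 𝓘(ℂ, E)
      {t : ComplexTorus Φ | ∃ C, IsIrreducibleComponent 𝓘(ℂ, E) Y C ∧ C ⊆ t +ᵥ D} := by
  have hfin := finite_isIrreducibleComponent Φ hY
  have h : {t : ComplexTorus Φ | ∃ C, IsIrreducibleComponent 𝓘(ℂ, E) Y C ∧ C ⊆ t +ᵥ D} =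
      ⋃ C ∈ hfin.toFinset, {t : ComplexTorus Φ | C ⊆ t +ᵥ D} := by
    ext t
    simp only [mem_setOf_eq, mem_iUnion, Set.Finite.mem_toFinset, exists_prop]
  rw [h]
  exact isAnalyticSet_biUnion_finset _ fun C _ ↦ isAnalyticSet_setOf_subset_vadd Φ C hD

omit [DecidableEq ι] [MeasurableSpace E] [BorelSpace E] in
/-- `(· + t)⁻¹'` spelling: **`{t ∈ X | ∃ C irreducible component of Y, C ⊆ D − t}` is closed analytic.**
[cite: Chirka1989, §5.4 Thm. (p. 57) and §5.7 Theorem (p. 62)] [cite: Fulton1998, Appendix B.9.2] -/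
theorem isAnalyticSet_setOf_exists_isIrreducibleComponent_subset_preimage_add {Y D : Set (ComplexTorus Φ)}
    (hY : IsAnalyticSet 𝓘(ℂ, E) Y) (hD : IsAnalyticSet 𝓘(ℂ, E) D) :
    IsAnalyticSet 𝓘(ℂ, E)
      {t : ComplexTorus Φ | ∃ C, IsIrreducibleComponent 𝓘(ℂ, E) Y C ∧ C ⊆ (fun x ↦ x + t) ⁻¹' D} := by
  have hfin := finite_isIrreducibleComponent Φ hY
  have h : {t : ComplexTorus Φ | ∃ C, IsIrreducibleComponent 𝓘(ℂ, E) Y C ∧ C ⊆ (fun x ↦ x + t) ⁻¹' D} =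
      ⋃ C ∈ hfin.toFinset, {t : ComplexTorus Φ | C ⊆ (fun x ↦ x + t) ⁻¹' D} := by
    ext t
    simp only [mem_setOf_eq, mem_iUnion, Set.Finite.mem_toFinset, exists_prop]
  rw [h]
  exact isAnalyticSet_biUnion_finset _ fun C _ ↦ isAnalyticSet_setOf_subset_preimage_add Φ C hD

omit [DecidableEq ι] [MeasurableSpace E] [BorelSpace E] in
/-- `B(Y, D)` is closed. [cite: Chirka1989, §5.7 Theorem, p. 62] -/
theorem isClosed_setOf_exists_isIrreducibleComponent_subset_vadd {Y D : Set (ComplexTorus Φ)}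
    (hY : IsAnalyticSet 𝓘(ℂ, E) Y) (hD : IsAnalyticSet 𝓘(ℂ, E) D) :
    IsClosed {t : ComplexTorus Φ | ∃ C, IsIrreducibleComponent 𝓘(ℂ, E) Y C ∧ C ⊆ t +ᵥ D} :=
  (isAnalyticSet_setOf_exists_isIrreducibleComponent_subset_vadd Φ hY hD).isClosed

/-! ### §2 `B(Y, D)` is the set of improper translates -/

omit [DecidableEq ι] [MeasurableSpace E] [BorelSpace E] in
/-- **`Y ∩ (t + D)` is proper iff no component of `Y` lies in `t + D`** (file 23 for the translate `t + D`,
which is again a hypersurface). [cite: Chirka1989, §5.3 Cor. 1 (p. 55) and §3.5 Prop. 3 (p. 37)]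
[cite: Fulton1998, §7.1 and Example 8.4.6] -/
theorem inter_vadd_eq_empty_or_hasPureDim_iff_forall_isIrreducibleComponent_not_subset {q r : ℕ}
    (hq1 : q + 1 = finrank ℂ E) {Y D : Set (ComplexTorus Φ)} (hY : HasPureDim 𝓘(ℂ, E) Y (r + 1))
    (hD : HasPureDim 𝓘(ℂ, E) D q) (t : ComplexTorus Φ) :
    (Y ∩ (t +ᵥ D) = ∅ ∨ HasPureDim 𝓘(ℂ, E) (Y ∩ (t +ᵥ D)) r) ↔
      ∀ C, IsIrreducibleComponent 𝓘(ℂ, E) Y C → ¬ C ⊆ t +ᵥ D :=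
  inter_eq_empty_or_hasPureDim_iff_forall_isIrreducibleComponent_not_subset Φ hq1 hY (hasPureDim_vadd Φ hD t)

omit [DecidableEq ι] [MeasurableSpace E] [BorelSpace E] in
/-- **THE IMPROPER TRANSLATES ARE EXACTLY THE SWALLOWING LOCUS**:
`{t | Y ∩ (t + D) is neither ∅ nor pure of dimension r} = B(Y, D)`.
[cite: Chirka1989, §5.3 Cor. 1 (p. 55)] [cite: Fulton1998, §7.1 and Example 8.4.6] -/
theorem setOf_not_inter_vadd_eq_empty_or_hasPureDim_eq {q r : ℕ} (hq1 : q + 1 = finrank ℂ E)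
    {Y D : Set (ComplexTorus Φ)} (hY : HasPureDim 𝓘(ℂ, E) Y (r + 1)) (hD : HasPureDim 𝓘(ℂ, E) D q) :
    {t : ComplexTorus Φ | ¬ (Y ∩ (t +ᵥ D) = ∅ ∨ HasPureDim 𝓘(ℂ, E) (Y ∩ (t +ᵥ D)) r)} =
      {t : ComplexTorus Φ | ∃ C, IsIrreducibleComponent 𝓘(ℂ, E) Y C ∧ C ⊆ t +ᵥ D} := by
  ext t
  rw [mem_setOf_eq, mem_setOf_eq,
    inter_vadd_eq_empty_or_hasPureDim_iff_forall_isIrreducibleComponent_not_subset Φ hq1 hY hD t]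
  push Not
  rfl

omit [DecidableEq ι] [MeasurableSpace E] [BorelSpace E] in
/-- **THE IMPROPER TRANSLATES OF A HYPERSURFACE FORM A CLOSED ANALYTIC SUBSET OF `X`.**
[cite: Chirka1989, §5.3 Cor. 1 (p. 55), §5.4 Thm. (p. 57), §5.7 Theorem (p. 62)]
[cite: Fulton1998, Appendix B.9.2] -/
theorem isAnalyticSet_setOf_not_inter_vadd_eq_empty_or_hasPureDim {q r : ℕ} (hq1 : q + 1 = finrank ℂ E)
    {Y D : Set (ComplexTorus Φ)} (hY : HasPureDim 𝓘(ℂ, E) Y (r + 1)) (hD : HasPureDim 𝓘(ℂ, E) D q) :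
    IsAnalyticSet 𝓘(ℂ, E)
      {t : ComplexTorus Φ | ¬ (Y ∩ (t +ᵥ D) = ∅ ∨ HasPureDim 𝓘(ℂ, E) (Y ∩ (t +ᵥ D)) r)} := by
  rw [setOf_not_inter_vadd_eq_empty_or_hasPureDim_eq Φ hq1 hY hD]
  exact isAnalyticSet_setOf_exists_isIrreducibleComponent_subset_vadd Φ hY.isAnalyticSet hD.isAnalyticSet

omit [DecidableEq ι] [MeasurableSpace E] [BorelSpace E] in
/-- **The proper translates form an open subset of `X`** (complement of a closed analytic subset; compare the
semicontinuity statement `isOpen_setOf_hasPureDim_inter_vadd`). [cite: Chirka1989, §5.7 Theorem, p. 62] -/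
theorem isOpen_setOf_inter_vadd_eq_empty_or_hasPureDim {q r : ℕ} (hq1 : q + 1 = finrank ℂ E)
    {Y D : Set (ComplexTorus Φ)} (hY : HasPureDim 𝓘(ℂ, E) Y (r + 1)) (hD : HasPureDim 𝓘(ℂ, E) D q) :
    IsOpen {t : ComplexTorus Φ | Y ∩ (t +ᵥ D) = ∅ ∨ HasPureDim 𝓘(ℂ, E) (Y ∩ (t +ᵥ D)) r} := by
  rw [← isClosed_compl_iff, compl_setOf]
  exact (isAnalyticSet_setOf_not_inter_vadd_eq_empty_or_hasPureDim Φ hq1 hY hD).isClosed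

/-! ### §3 `B(Y, D)` is a null set: almost every translate is proper -/

/-- **Almost every translate `t + Y₂` meets `Y₁` properly** (the moving lemma, `t +ᵥ` spelling): for
`Y₁, Y₂ ⊆ X` of pure dimensions `d₁, d₂` with `d₁ + d₂ = q + g`, for Haar-a.e. `t` the intersection
`Y₁ ∩ (t + Y₂)` is empty or of pure dimension `q`. [cite: Fulton1998, §11.4, Example 11.4.5 and Appendix B.9.2]
[cite: Kleiman1974Transversality, Thm. 2] -/
theorem ae_inter_vadd_eq_empty_or_hasPureDim {d₁ d₂ q : ℕ} (hdim : d₁ + d₂ = q + finrank ℂ E)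
    {Y₁ Y₂ : Set (ComplexTorus Φ)} (hY₁ : HasPureDim 𝓘(ℂ, E) Y₁ d₁) (hY₂ : HasPureDim 𝓘(ℂ, E) Y₂ d₂) :
    ∀ᵐ t ∂(volume : Measure (ComplexTorus Φ)),
      Y₁ ∩ (t +ᵥ Y₂) = ∅ ∨ HasPureDim 𝓘(ℂ, E) (Y₁ ∩ (t +ᵥ Y₂)) q := by
  have hpre : ∀ s : ComplexTorus Φ, (fun x ↦ x + s) ⁻¹' Y₂ = -s +ᵥ Y₂ := by
    intro s
    ext x
    rw [mem_preimage, Set.mem_vadd_set_iff_neg_vadd_mem, neg_neg, vadd_eq_add, add_comm]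
  have hneg : ∀ᵐ t ∂(volume : Measure (ComplexTorus Φ)),
      Y₁ ∩ ((-t : ComplexTorus Φ) +ᵥ Y₂) = ∅ ∨ HasPureDim 𝓘(ℂ, E) (Y₁ ∩ ((-t : ComplexTorus Φ) +ᵥ Y₂)) q := by
    filter_upwards [ae_inter_translate_eq_empty_or_hasPureDim Φ hdim hY₁ hY₂] with t ht
    rwa [hpre] at ht
  rw [ae_iff] at hneg ⊢
  rw [← Measure.measure_preimage_neg (volume : Measure (ComplexTorus Φ))]
  exact hneg

/-- **`B(Y, D)` HAS HAAR MEASURE ZERO.** [cite: Fulton1998, §11.4, Example 11.4.5 and Appendix B.9.2]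
[cite: Kleiman1974Transversality, Thm. 2] -/
theorem volume_setOf_exists_isIrreducibleComponent_subset_vadd_eq_zero {q r : ℕ} (hq1 : q + 1 = finrank ℂ E)
    {Y D : Set (ComplexTorus Φ)} (hY : HasPureDim 𝓘(ℂ, E) Y (r + 1)) (hD : HasPureDim 𝓘(ℂ, E) D q) :
    (volume : Measure (ComplexTorus Φ))
        {t : ComplexTorus Φ | ∃ C, IsIrreducibleComponent 𝓘(ℂ, E) Y C ∧ C ⊆ t +ᵥ D} = 0 := by
  rw [← setOf_not_inter_vadd_eq_empty_or_hasPureDim_eq Φ hq1 hY hD, ← ae_iff]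
  exact ae_inter_vadd_eq_empty_or_hasPureDim Φ (by omega) hY hD

/-- **The improper translates have measure zero.** [cite: Fulton1998, §11.4, Example 11.4.5 and Appendix B.9.2]
[cite: Kleiman1974Transversality, Thm. 2] -/
theorem volume_setOf_not_inter_vadd_eq_empty_or_hasPureDim_eq_zero {q r : ℕ} (hq1 : q + 1 = finrank ℂ E)
    {Y D : Set (ComplexTorus Φ)} (hY : HasPureDim 𝓘(ℂ, E) Y (r + 1)) (hD : HasPureDim 𝓘(ℂ, E) D q) :
    (volume : Measure (ComplexTorus Φ))
        {t : ComplexTorus Φ | ¬ (Y ∩ (t +ᵥ D) = ∅ ∨ HasPureDim 𝓘(ℂ, E) (Y ∩ (t +ᵥ D)) r)} = 0 := by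
  rw [← ae_iff]
  exact ae_inter_vadd_eq_empty_or_hasPureDim Φ (by omega) hY hD

/-- **The proper translates form an OPEN DENSE subset of FULL MEASURE.**
[cite: Fulton1998, §11.4, Example 11.4.5 and Appendix B.9.2] [cite: Kleiman1974Transversality, Thm. 2]
[cite: Chirka1989, §5.7 Theorem, p. 62] -/
theorem isOpen_dense_setOf_inter_vadd_eq_empty_or_hasPureDim {q r : ℕ} (hq1 : q + 1 = finrank ℂ E)
    {Y D : Set (ComplexTorus Φ)} (hY : HasPureDim 𝓘(ℂ, E) Y (r + 1)) (hD : HasPureDim 𝓘(ℂ, E) D q) :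
    IsOpen {t : ComplexTorus Φ | Y ∩ (t +ᵥ D) = ∅ ∨ HasPureDim 𝓘(ℂ, E) (Y ∩ (t +ᵥ D)) r} ∧
      Dense {t : ComplexTorus Φ | Y ∩ (t +ᵥ D) = ∅ ∨ HasPureDim 𝓘(ℂ, E) (Y ∩ (t +ᵥ D)) r} ∧
      ∀ᵐ t ∂(volume : Measure (ComplexTorus Φ)), Y ∩ (t +ᵥ D) = ∅ ∨ HasPureDim 𝓘(ℂ, E) (Y ∩ (t +ᵥ D)) r :=
  have hae := ae_inter_vadd_eq_empty_or_hasPureDim Φ (d₁ := r + 1) (d₂ := q) (q := r) (by omega) hY hD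
  ⟨isOpen_setOf_inter_vadd_eq_empty_or_hasPureDim Φ hq1 hY hD, Measure.dense_of_ae hae, hae⟩

/-- **`B(Y, D) ≠ X`**: some translate of the hypersurface `D` cuts `Y` properly.
[cite: Fulton1998, §11.4 and Example 11.4.5] [cite: Kleiman1974Transversality, Thm. 2] -/
theorem setOf_exists_isIrreducibleComponent_subset_vadd_ne_univ {q r : ℕ} (hq1 : q + 1 = finrank ℂ E)
    {Y D : Set (ComplexTorus Φ)} (hY : HasPureDim 𝓘(ℂ, E) Y (r + 1)) (hD : HasPureDim 𝓘(ℂ, E) D q) :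
    {t : ComplexTorus Φ | ∃ C, IsIrreducibleComponent 𝓘(ℂ, E) Y C ∧ C ⊆ t +ᵥ D} ≠ univ := by
  obtain ⟨t, ht⟩ :=
    (ae_inter_vadd_eq_empty_or_hasPureDim Φ (d₁ := r + 1) (d₂ := q) (q := r) (by omega) hY hD).exists
  rw [← setOf_not_inter_vadd_eq_empty_or_hasPureDim_eq Φ hq1 hY hD, Ne, eq_univ_iff_forall]
  exact fun h ↦ h t ht

/-- **`B(Y, D)` has empty interior** (a closed analytic null set; equivalently its complement, the set of
proper translates, is dense). [cite: Chirka1989, §2.2 Cor. (p. 21) and §5.7 Theorem (p. 62)]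
[cite: Fulton1998, §11.4 and Example 11.4.5] -/
theorem interior_setOf_exists_isIrreducibleComponent_subset_vadd_eq_empty {q r : ℕ}
    (hq1 : q + 1 = finrank ℂ E) {Y D : Set (ComplexTorus Φ)} (hY : HasPureDim 𝓘(ℂ, E) Y (r + 1))
    (hD : HasPureDim 𝓘(ℂ, E) D q) :
    interior {t : ComplexTorus Φ | ∃ C, IsIrreducibleComponent 𝓘(ℂ, E) Y C ∧ C ⊆ t +ᵥ D} = ∅ := by
  rw [interior_eq_empty_iff_dense_compl, ← setOf_not_inter_vadd_eq_empty_or_hasPureDim_eq Φ hq1 hY hD,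
    compl_setOf]
  simp only [not_not]
  exact (isOpen_dense_setOf_inter_vadd_eq_empty_or_hasPureDim Φ hq1 hY hD).2.1

/-! ### §4 The `D − t = (· + t)⁻¹' D` spelling of the iterated sections -/

omit [DecidableEq ι] [MeasurableSpace E] [BorelSpace E] in
/-- `(· + t)⁻¹'` spelling of §2: **`{t | Y ∩ (D − t) is neither ∅ nor pure of dimension r} =
{t | ∃ C irreducible component of Y, C ⊆ D − t}`.** [cite: Chirka1989, §5.3 Cor. 1 (p. 55)]
[cite: Fulton1998, §7.1 and Example 8.4.6] -/
theorem setOf_not_inter_preimage_add_eq_empty_or_hasPureDim_eq {q r : ℕ} (hq1 : q + 1 = finrank ℂ E)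
    {Y D : Set (ComplexTorus Φ)} (hY : HasPureDim 𝓘(ℂ, E) Y (r + 1)) (hD : HasPureDim 𝓘(ℂ, E) D q) :
    {t : ComplexTorus Φ | ¬ (Y ∩ (fun x ↦ x + t) ⁻¹' D = ∅ ∨
        HasPureDim 𝓘(ℂ, E) (Y ∩ (fun x ↦ x + t) ⁻¹' D) r)} =
      {t : ComplexTorus Φ | ∃ C, IsIrreducibleComponent 𝓘(ℂ, E) Y C ∧ C ⊆ (fun x ↦ x + t) ⁻¹' D} := by
  have hpre : ∀ s : ComplexTorus Φ, (fun x ↦ x + s) ⁻¹' D = -s +ᵥ D := by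
    intro s
    ext x
    rw [mem_preimage, Set.mem_vadd_set_iff_neg_vadd_mem, neg_neg, vadd_eq_add, add_comm]
  ext t
  rw [mem_setOf_eq, mem_setOf_eq, hpre,
    inter_vadd_eq_empty_or_hasPureDim_iff_forall_isIrreducibleComponent_not_subset Φ hq1 hY hD (-t)]
  push Not
  rfl

omit [DecidableEq ι] [MeasurableSpace E] [BorelSpace E] in
/-- `(· + t)⁻¹'` spelling: **the improper translates `{t | Y ∩ (D − t) improper}` form a closed analytic subset
of `X`.** [cite: Chirka1989, §5.3 Cor. 1 (p. 55), §5.4 Thm. (p. 57), §5.7 Theorem (p. 62)]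
[cite: Fulton1998, Appendix B.9.2] -/
theorem isAnalyticSet_setOf_not_inter_preimage_add_eq_empty_or_hasPureDim {q r : ℕ}
    (hq1 : q + 1 = finrank ℂ E) {Y D : Set (ComplexTorus Φ)} (hY : HasPureDim 𝓘(ℂ, E) Y (r + 1))
    (hD : HasPureDim 𝓘(ℂ, E) D q) :
    IsAnalyticSet 𝓘(ℂ, E) {t : ComplexTorus Φ | ¬ (Y ∩ (fun x ↦ x + t) ⁻¹' D = ∅ ∨
        HasPureDim 𝓘(ℂ, E) (Y ∩ (fun x ↦ x + t) ⁻¹' D) r)} := by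
  rw [setOf_not_inter_preimage_add_eq_empty_or_hasPureDim_eq Φ hq1 hY hD]
  exact isAnalyticSet_setOf_exists_isIrreducibleComponent_subset_preimage_add Φ hY.isAnalyticSet
    hD.isAnalyticSet

/-- `(· + t)⁻¹'` spelling: **the improper translates have Haar measure zero and the proper ones form an
open dense subset of full measure.** [cite: Fulton1998, §11.4, Example 11.4.5 and Appendix B.9.2]
[cite: Kleiman1974Transversality, Thm. 2] [cite: Chirka1989, §5.7 Theorem, p. 62] -/
theorem volume_eq_zero_and_isOpen_dense_setOf_inter_preimage_add_eq_empty_or_hasPureDim {q r : ℕ}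
    (hq1 : q + 1 = finrank ℂ E) {Y D : Set (ComplexTorus Φ)} (hY : HasPureDim 𝓘(ℂ, E) Y (r + 1))
    (hD : HasPureDim 𝓘(ℂ, E) D q) :
    (volume : Measure (ComplexTorus Φ)) {t : ComplexTorus Φ | ¬ (Y ∩ (fun x ↦ x + t) ⁻¹' D = ∅ ∨
        HasPureDim 𝓘(ℂ, E) (Y ∩ (fun x ↦ x + t) ⁻¹' D) r)} = 0 ∧
      IsOpen {t : ComplexTorus Φ | Y ∩ (fun x ↦ x + t) ⁻¹' D = ∅ ∨
        HasPureDim 𝓘(ℂ, E) (Y ∩ (fun x ↦ x + t) ⁻¹' D) r} ∧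
      Dense {t : ComplexTorus Φ | Y ∩ (fun x ↦ x + t) ⁻¹' D = ∅ ∨
        HasPureDim 𝓘(ℂ, E) (Y ∩ (fun x ↦ x + t) ⁻¹' D) r} := by
  have hae := ae_inter_translate_eq_empty_or_hasPureDim Φ (d₁ := r + 1) (d₂ := q) (q := r) (by omega) hY hD
  refine ⟨ae_iff.1 hae, ?_, Measure.dense_of_ae hae⟩
  rw [← isClosed_compl_iff, compl_setOf]
  exact (isAnalyticSet_setOf_not_inter_preimage_add_eq_empty_or_hasPureDim Φ hq1 hY hD).isClosed


/-! ### §5 General `Y₂`: the swallowing locus is Haar-null whenever `dim Y₂ < g` -/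

omit [Fintype ι] [DecidableEq ι] [FiniteDimensional ℂ E] [MeasurableSpace E] [BorelSpace E] in
/-- **`{t | C ⊆ t + Y₂} ⊆ c − Y₂`** for any point `c ∈ C`. [cite: Fulton1998, Appendix B.9.2] -/
theorem setOf_subset_vadd_subset_vadd_neg {C Y₂ : Set (ComplexTorus Φ)} {c : ComplexTorus Φ} (hc : c ∈ C) :
    {t : ComplexTorus Φ | C ⊆ t +ᵥ Y₂} ⊆ c +ᵥ (-Y₂) := by
  intro t ht
  obtain ⟨y, hy, hyc⟩ := Set.mem_vadd_set.1 (ht hc)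
  refine Set.mem_vadd_set.2 ⟨-y, Set.neg_mem_neg.2 hy, ?_⟩
  rw [← hyc, vadd_eq_add, vadd_eq_add]
  abel

omit [DecidableEq ι] in
/-- **`{t | C ⊆ t + Y₂}` is Haar-null** for `C ≠ ∅` and `Y₂` of pure dimension `d₂ < g` (it lies in a
translate of `−Y₂`). [cite: Chirka1989, §3.7 Cor., p. 39] [cite: Fulton1998, Appendix B.9.2] -/
theorem volume_setOf_subset_vadd_eq_zero {C Y₂ : Set (ComplexTorus Φ)} (hC : C.Nonempty) {d₂ : ℕ}
    (hY₂ : HasPureDim 𝓘(ℂ, E) Y₂ d₂) (hd₂ : d₂ < finrank ℂ E) :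
    (volume : Measure (ComplexTorus Φ)) {t : ComplexTorus Φ | C ⊆ t +ᵥ Y₂} = 0 := by
  obtain ⟨c, hc⟩ := hC
  exact measure_mono_null (setOf_subset_vadd_subset_vadd_neg Φ hc)
    (volume_eq_zero_of_hasPureDim_lt Φ (hasPureDim_vadd Φ (hasPureDim_neg Φ hY₂) c) hd₂)

omit [DecidableEq ι] in
/-- **THE SWALLOWING LOCUS `B(Y₁, Y₂)` IS HAAR-NULL** for closed analytic `Y₁` and `Y₂` of pure dimension
`d₂ < g` (finitely many components, each `{t | C ⊆ t + Y₂}` null).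
[cite: Chirka1989, §3.7 Cor. (p. 39) and §5.4 Thm. (p. 57)]
[cite: Fulton1998, Appendix B.9.2] -/
theorem volume_setOf_exists_isIrreducibleComponent_subset_vadd_eq_zero_of_lt {Y₁ Y₂ : Set (ComplexTorus Φ)}
    (hY₁ : IsAnalyticSet 𝓘(ℂ, E) Y₁) {d₂ : ℕ} (hY₂ : HasPureDim 𝓘(ℂ, E) Y₂ d₂) (hd₂ : d₂ < finrank ℂ E) :
    (volume : Measure (ComplexTorus Φ))
        {t : ComplexTorus Φ | ∃ C, IsIrreducibleComponent 𝓘(ℂ, E) Y₁ C ∧ C ⊆ t +ᵥ Y₂} = 0 := by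
  have hfin := finite_isIrreducibleComponent Φ hY₁
  have h : {t : ComplexTorus Φ | ∃ C, IsIrreducibleComponent 𝓘(ℂ, E) Y₁ C ∧ C ⊆ t +ᵥ Y₂} =
      ⋃ C ∈ {C : Set (ComplexTorus Φ) | IsIrreducibleComponent 𝓘(ℂ, E) Y₁ C},
        {t : ComplexTorus Φ | C ⊆ t +ᵥ Y₂} := by
    ext t
    simp only [mem_setOf_eq, mem_iUnion, exists_prop]
  rw [h]
  exact (measure_biUnion_null_iff hfin.countable).2 fun C hC ↦
    volume_setOf_subset_vadd_eq_zero Φ hC.nonempty hY₂ hd₂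

omit [DecidableEq ι] in
/-- **`B(Y₁, Y₂)` is a closed analytic subset with empty interior and `≠ X`** (`dim Y₂ < g`).
[cite: Chirka1989, §2.2 Cor. (p. 21), §3.7 Cor. (p. 39), §5.7 Theorem (p. 62)] [cite: Fulton1998, Appendix B.9.2] -/
theorem interior_setOf_exists_isIrreducibleComponent_subset_vadd_eq_empty_of_lt {Y₁ Y₂ : Set (ComplexTorus Φ)}
    (hY₁ : IsAnalyticSet 𝓘(ℂ, E) Y₁) {d₂ : ℕ} (hY₂ : HasPureDim 𝓘(ℂ, E) Y₂ d₂) (hd₂ : d₂ < finrank ℂ E) :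
    interior {t : ComplexTorus Φ | ∃ C, IsIrreducibleComponent 𝓘(ℂ, E) Y₁ C ∧ C ⊆ t +ᵥ Y₂} = ∅ ∧
      {t : ComplexTorus Φ | ∃ C, IsIrreducibleComponent 𝓘(ℂ, E) Y₁ C ∧ C ⊆ t +ᵥ Y₂} ≠ univ := by
  have h0 := volume_setOf_exists_isIrreducibleComponent_subset_vadd_eq_zero_of_lt Φ hY₁ hY₂ hd₂
  have hint : interior {t : ComplexTorus Φ | ∃ C, IsIrreducibleComponent 𝓘(ℂ, E) Y₁ C ∧ C ⊆ t +ᵥ Y₂} = ∅ := by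
    by_contra hne
    have hpos := (isOpen_interior.measure_pos (volume : Measure (ComplexTorus Φ))
      (nonempty_iff_ne_empty.2 hne)).ne'
    exact hpos (measure_mono_null interior_subset h0)
  refine ⟨hint, fun h ↦ ?_⟩
  rw [h, interior_univ] at hint
  exact univ_nonempty.ne_empty hint

omit [DecidableEq ι] [MeasurableSpace E] [BorelSpace E] in
/-- **Swallowed components make the translate improper**: if `Y₁` has pure dimension `d₁ > q` (e.g.
`q = d₁ + d₂ − g` the expected dimension, `dim Y₂ = d₂ < g`), then every `t ∈ B(Y₁, Y₂)` is an IMPROPER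
translate: `Y₁ ∩ (t + Y₂) ⊇ C` is neither empty nor of pure dimension `q`.
[cite: Chirka1989, §5.3 Cor. 1, p. 55] [cite: Fulton1998, §7.1 and Example 11.4.5] -/
theorem setOf_exists_isIrreducibleComponent_subset_vadd_subset_setOf_not {Y₁ : Set (ComplexTorus Φ)}
    (Y₂ : Set (ComplexTorus Φ)) {d₁ q : ℕ} (hY₁ : HasPureDim 𝓘(ℂ, E) Y₁ d₁) (hq : q < d₁) :
    {t : ComplexTorus Φ | ∃ C, IsIrreducibleComponent 𝓘(ℂ, E) Y₁ C ∧ C ⊆ t +ᵥ Y₂} ⊆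
      {t : ComplexTorus Φ | ¬ (Y₁ ∩ (t +ᵥ Y₂) = ∅ ∨ HasPureDim 𝓘(ℂ, E) (Y₁ ∩ (t +ᵥ Y₂)) q)} := by
  rintro t ⟨C, hC, hCt⟩
  have hCd : HasPureDim 𝓘(ℂ, E) C d₁ := hC.hasPureDim hY₁
  have hsub : C ⊆ Y₁ ∩ (t +ᵥ Y₂) := subset_inter hC.subset hCt
  rintro (h | h)
  · exact hC.nonempty.ne_empty (eq_empty_of_subset_empty (h ▸ hsub))
  · have := le_of_subset_of_hasPureDim Φ h hCd hsub
    omega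

omit [DecidableEq ι] in
/-- Hence, for `d₁ + d₂ = q + g`, `d₂ < g`: `B(Y₁, Y₂)` is a closed analytic null subset of the (also null,
by the moving lemma) set of improper translates. [cite: Fulton1998, §11.4, Example 11.4.5 and Appendix B.9.2] -/
theorem isAnalyticSet_and_volume_eq_zero_setOf_exists_isIrreducibleComponent_subset_vadd
    {Y₁ Y₂ : Set (ComplexTorus Φ)} {d₁ d₂ : ℕ} (hY₁ : HasPureDim 𝓘(ℂ, E) Y₁ d₁)
    (hY₂ : HasPureDim 𝓘(ℂ, E) Y₂ d₂) (hd₂ : d₂ < finrank ℂ E) :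
    IsAnalyticSet 𝓘(ℂ, E) {t : ComplexTorus Φ | ∃ C, IsIrreducibleComponent 𝓘(ℂ, E) Y₁ C ∧ C ⊆ t +ᵥ Y₂} ∧
      (volume : Measure (ComplexTorus Φ))
        {t : ComplexTorus Φ | ∃ C, IsIrreducibleComponent 𝓘(ℂ, E) Y₁ C ∧ C ⊆ t +ᵥ Y₂} = 0 :=
  ⟨isAnalyticSet_setOf_exists_isIrreducibleComponent_subset_vadd Φ hY₁.isAnalyticSet hY₂.isAnalyticSet,
    volume_setOf_exists_isIrreducibleComponent_subset_vadd_eq_zero_of_lt Φ hY₁.isAnalyticSet hY₂ hd₂⟩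

end ComplexTorus

end Literature.Geometry.Kaehler
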